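import Literature.AnabelianGeometry.AbsoluteAnabelian.AbsAnabStarConditionSplitCompletion
import Literature.AnabelianGeometry.AbsoluteAnabelian.AbsTopIThm26SplitModelInstances
import Literature.AnabelianGeometry.AbsoluteAnabelian.AbsTopIThm26vHolds
import HarnessLib

/-!
# [AbsTopI] Thm 2.6 (v), Thm 2.14 (i) and [AbsAnab] Lemma 1.1.4 (ii) AT THE SPLIT FREE MODEL
# `F̂_n × G_K ↠ G_K` — instance forms with NON-ABELIAN `Δ`, BY NAME from condition (∗)

S. Mochizuki, *Topics in Absolute Anabelian Geometry I* (2012) [AbsTopI], Thm 2.6 (v) p. 22 ("the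
kernel of the quotient `Π ↠ G` may be characterized group-theoretically"; typed `Thm26v`, FACT-LIST
F-0249) and Thm 2.14 (i) p. 33 (group-theoretic part, typed `Thm214GroupPart`, F-0245); *The Absolute
Anabelian Geometry of Hyperbolic Curves* (2004) [AbsAnab], Lemma 1.1.4 (ii) p. 7 (display
`[G : G′]·[K : ℚ_p] = δ¹_p(Π′) − δ¹_l(Π′)`, typed `lemma114_ii`, PROVED in the tree as
`lemma114_ii_holds` from the printed hypotheses: splitting over an open subgroup of `G`, `Δ`
topologically finitely generated, condition (∗)).

abc-iut-f-090's `AbsAnabStarConditionSplitCompletion.lean` proves (∗) (`StarCondition`) at the split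
model `Γ̂ × G ↠ G` (every finitely generated `Γ`, every profinite `G`); at `F̂_n × G_K` (`K/ℚ_p`
finite) ALL printed hypotheses of Lemma 1.1.4 (ii) therefore hold, and the tree's closers fire BY
NAME.  This PROOF-ONLY file (no definition, no instance; abc-iut cell, block F seat abc-iut-f-090
gen 3, row «STAR-SPLIT-NONABELIAN») records the resulting instance forms with NON-ABELIAN `Δ = F̂_n`:

* `isTopologicallyFinitelyGenerated_geom_split` — `Δ = Γ̂ × 1` is topologically finitely generated;
* **`thm26v_split_profiniteCompletion_freeGroup`** — the typed Thm 2.6 (v) (F-0249) at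
  `F̂_n × G_K ↠ G_K` with MLF base datum `(p, K, refl)`: "`ζ(Π) = [K : ℚ_p]`" and
  `Δ = ⋂ {H open | ζ(H)/ζ(Π) = [Π : H]}` — via abc-iut-L4's `thm26v_of_starCondition`
  (`lemma114_ii_holds`, local class field theory in the kernel); `lemma114Display_split_…` — the
  printed display of Lemma 1.1.4 (ii) at every open `Π″`;
* **`preservesGeom_split_profiniteCompletion_freeGroup`** — EVERY isomorphism of topological groups
  `F̂_n × G_K ⥲ F̂_m × G_L` (`K/ℚ_p`, `L/ℚ_q` finite) carries `F̂_n × 1` onto `F̂_m × 1` ([AbsTopI]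
  Thm 2.6 (v) "group-theoretic characterisation of `Δ`"; F-0007 `PreservesGeom` with non-abelian
  `Δ`), and `residueChar_eq_split_…` forces `p = q`; `thm214GroupPart_split_…` — the typed Thm 2.14
  (i) group part (F-0245) for every such isomorphism.

HONEST LABEL: split model = trivial outer action; a satisfiability / consistency witness of the typed
statements with NON-ABELIAN `Δ`, NOT the extension of a curve (no étale `π₁` in the tree).  [AbsTopI]
and [AbsAnab] are refereed; nothing here bears on [IUTchIII] Cor. 3.12 or takes a side; typed ≠ proved
elsewhere.  Theorems only; axioms standard.
-/

noncomputable section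

open Topology Field

namespace Literature.AnabelianGeometry.AbsoluteAnabelian

namespace FundamentalExtension

open Literature.AnabelianGeometry.SemiGraphs.SemiGraphOfAnabelioids
open Literature.IUT.HodgeTheaters (profiniteCompletion toCompletion)

/-- In the split model `Γ̂ × G_K ↠ G_K` with `Γ` finitely generated, `Δ = Γ̂ × 1` is topologically
finitely generated (image of `Γ̂`, itself topologically finitely generated as a pro-`𝔓𝔯𝔦𝔪𝔢𝔰`
completion of a finitely generated group). [cite: MochizukiAbsTopI2012, Prop 2.2 p.20] -/
theorem isTopologicallyFinitelyGenerated_geom_split (Γ : Type) [Group Γ] [Group.FG Γ] (K : Type)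
    [Field K] [CharZero K] :
    IsTopologicallyFinitelyGenerated
      (⟨ProfiniteGrp.of (profiniteCompletion Γ × absoluteGaloisGroup K), absoluteGaloisGrp K,
          ContinuousMonoidHom.snd (profiniteCompletion Γ) (absoluteGaloisGroup K),
          Prod.snd_surjective⟩ : FundamentalExtension.{0}).geom := by
  obtain ⟨j, hj⟩ := exists_surjective_toGeom_split (profiniteCompletion Γ) K
  exact (IsProSigmaCompletion.isTopologicallyFinitelyGenerated_of_fg
    (IsProSigmaCompletion.isProSigmaCompletion_toCompletion Γ)).of_surjective j hj

/-- **F-0249 — [AbsTopI] Thm 2.6 (v) AS TYPED (`Thm26v`, case `Θ = {1}`) at the split free model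
`Π := F̂_n × G_K ↠ G_K`** (`K/ℚ_p` finite, MLF base datum `(p, K, refl)`), UNCONDITIONAL — instance
form with NON-ABELIAN `Δ = F̂_n`: "`ζ(Π) = [K : ℚ_p]`" and "`Δ = ⋂ {H ⊆ Π open | ζ(H)/ζ(Π) = [Π : H]}`".
All printed hypotheses of [AbsAnab] Lemma 1.1.4 (ii) hold here (splitting, `Δ` tfg, (∗) =
`starCondition_holds`), so abc-iut-L4's `thm26v_of_starCondition` fires.  HONEST LABEL: trivial outer
action. [cite: MochizukiAbsTopI2012, Thm 2.6 (v) p.22] -/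
theorem thm26v_split_profiniteCompletion_freeGroup (n p : ℕ) [Fact p.Prime] (K : Type) [Field K]
    [CharZero K] [Algebra ℚ_[p] K] [FiniteDimensional ℚ_[p] K] :
    Literature.AnabelianGeometry.AbsoluteAnabelian.FundamentalExtension.Thm26v
      (⟨ProfiniteGrp.of (profiniteCompletion (FreeGroup (Fin n)) × absoluteGaloisGroup K),
        absoluteGaloisGrp K,
        ContinuousMonoidHom.snd (profiniteCompletion (FreeGroup (Fin n))) (absoluteGaloisGroup K),
        Prod.snd_surjective⟩ : FundamentalExtension.{0})
      { p := p, K := K, galIso := ContinuousMulEquiv.refl _ } :=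
  thm26v_of_starCondition _ _ (splitsOverOpenSubgroup_holds n K)
    (isTopologicallyFinitelyGenerated_geom_split (FreeGroup (Fin n)) K) (starCondition_holds n K)

/-- **[AbsAnab] Lemma 1.1.4 (ii), the printed display, at the split free model** `F̂_n × G_K ↠ G_K`:
for every open `Π″` with image `G″` and every prime `l ≠ p`,
`[G_K : G″]·[K : ℚ_p] = δ¹_p(Π″) − δ¹_l(Π″)` (abc-iut-L4's `lemma114_ii_holds` at the printed
hypotheses, all of which hold here). [cite: MochizukiAbsAnab2004, Lemma 1.1.4 (ii) p.7] -/
theorem lemma114Display_split_profiniteCompletion_freeGroup (n p : ℕ) [Fact p.Prime] (K : Type) [Field K]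
    [CharZero K] [Algebra ℚ_[p] K] [FiniteDimensional ℚ_[p] K]
    (P : Subgroup (⟨ProfiniteGrp.of (profiniteCompletion (FreeGroup (Fin n)) × absoluteGaloisGroup K),
        absoluteGaloisGrp K,
        ContinuousMonoidHom.snd (profiniteCompletion (FreeGroup (Fin n))) (absoluteGaloisGroup K),
        Prod.snd_surjective⟩ : FundamentalExtension.{0}).arith)
    (hP : IsOpen (SetLike.coe P)) (l : ℕ) [Fact l.Prime] (hl : l ≠ p) :
    (((P.map (ContinuousMonoidHom.snd (profiniteCompletion (FreeGroup (Fin n)))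
        (absoluteGaloisGroup K)).toMonoidHom).index * Module.finrank ℚ_[p] K : ℕ) : ℕ∞) =
      freeProlRank P p - freeProlRank P l :=
  lemma114_ii_holds _ { p := p, K := K, galIso := ContinuousMulEquiv.refl _ }
    (splitsOverOpenSubgroup_holds n K) (isTopologicallyFinitelyGenerated_geom_split (FreeGroup (Fin n)) K)
    (starCondition_holds n K) P hP l hl

/-- **F-0245 — [AbsTopI] Thm 2.14 (i), group-theoretic part (`Thm214GroupPart`), between split free
models**: for EVERY isomorphism of topological groups `φ : F̂_n × G_K ⥲ F̂_m × G_L` (`K/ℚ_p`, `L/ℚ_q`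
finite): `p = q`, `φ(F̂_n × 1) = F̂_m × 1`, and the minimal almost-pro sets agree — abc-iut-L4's
`thm214GroupPart_of_starCondition` at the printed hypotheses of [AbsAnab] Lemma 1.1.4 (ii), all of
which hold at both models.  HONEST LABEL: trivial outer action. [cite: MochizukiAbsTopI2012, Thm 2.14 (i) p.33] -/
theorem thm214GroupPart_split_profiniteCompletion_freeGroup (n p : ℕ) [Fact p.Prime] (K : Type) [Field K]
    [CharZero K] [Algebra ℚ_[p] K] [FiniteDimensional ℚ_[p] K] (m q : ℕ) [Fact q.Prime]
    (L : Type) [Field L] [CharZero L] [Algebra ℚ_[q] L] [FiniteDimensional ℚ_[q] L]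
    (φ : (⟨ProfiniteGrp.of (profiniteCompletion (FreeGroup (Fin n)) × absoluteGaloisGroup K),
        absoluteGaloisGrp K,
        ContinuousMonoidHom.snd (profiniteCompletion (FreeGroup (Fin n))) (absoluteGaloisGroup K),
        Prod.snd_surjective⟩ : FundamentalExtension.{0}).arith ≃ₜ*
      (⟨ProfiniteGrp.of (profiniteCompletion (FreeGroup (Fin m)) × absoluteGaloisGroup L),
        absoluteGaloisGrp L,
        ContinuousMonoidHom.snd (profiniteCompletion (FreeGroup (Fin m))) (absoluteGaloisGroup L),
        Prod.snd_surjective⟩ : FundamentalExtension.{0}).arith) :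
    Thm214GroupPart { p := p, K := K, galIso := ContinuousMulEquiv.refl _ }
      { p := q, K := L, galIso := ContinuousMulEquiv.refl _ } φ :=
  thm214GroupPart_of_starCondition _ _ (splitsOverOpenSubgroup_holds n K)
    (isTopologicallyFinitelyGenerated_geom_split (FreeGroup (Fin n)) K) (starCondition_holds n K)
    (splitsOverOpenSubgroup_holds m L)
    (isTopologicallyFinitelyGenerated_geom_split (FreeGroup (Fin m)) L) (starCondition_holds m L) φ

/-- **[AbsTopI] Thm 2.6 (v) "group-theoretic characterisation of `Δ`" at the split free models
(F-0007 `PreservesGeom` with NON-ABELIAN `Δ`)**: EVERY isomorphism of topological groups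
`φ : F̂_n × G_K ⥲ F̂_m × G_L` (`K/ℚ_p`, `L/ℚ_q` finite) carries `Δ = F̂_n × 1` onto `F̂_m × 1`.
[cite: MochizukiAbsTopI2012, Thm 2.6 (v) p.22] -/
theorem preservesGeom_split_profiniteCompletion_freeGroup (n p : ℕ) [Fact p.Prime] (K : Type) [Field K]
    [CharZero K] [Algebra ℚ_[p] K] [FiniteDimensional ℚ_[p] K] (m q : ℕ) [Fact q.Prime]
    (L : Type) [Field L] [CharZero L] [Algebra ℚ_[q] L] [FiniteDimensional ℚ_[q] L]
    (φ : (⟨ProfiniteGrp.of (profiniteCompletion (FreeGroup (Fin n)) × absoluteGaloisGroup K),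
        absoluteGaloisGrp K,
        ContinuousMonoidHom.snd (profiniteCompletion (FreeGroup (Fin n))) (absoluteGaloisGroup K),
        Prod.snd_surjective⟩ : FundamentalExtension.{0}).arith ≃ₜ*
      (⟨ProfiniteGrp.of (profiniteCompletion (FreeGroup (Fin m)) × absoluteGaloisGroup L),
        absoluteGaloisGrp L,
        ContinuousMonoidHom.snd (profiniteCompletion (FreeGroup (Fin m))) (absoluteGaloisGroup L),
        Prod.snd_surjective⟩ : FundamentalExtension.{0}).arith) :
    PreservesGeom φ :=
  (thm214GroupPart_split_profiniteCompletion_freeGroup n p K m q L φ).2.1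

/-- **The residue characteristic is a group-theoretic invariant of `F̂_n × G_K`**: if
`F̂_n × G_K ≅ F̂_m × G_L` as topological groups (`K/ℚ_p`, `L/ℚ_q` finite), then `p = q`
([AbsTopI] Thm 2.14 (i) "`p₁ = p₂`"). [cite: MochizukiAbsTopI2012, Thm 2.14 (i) p.33] -/
theorem residueChar_eq_split_profiniteCompletion_freeGroup (n p : ℕ) [Fact p.Prime] (K : Type) [Field K]
    [CharZero K] [Algebra ℚ_[p] K] [FiniteDimensional ℚ_[p] K] (m q : ℕ) [Fact q.Prime]
    (L : Type) [Field L] [CharZero L] [Algebra ℚ_[q] L] [FiniteDimensional ℚ_[q] L]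
    (φ : (⟨ProfiniteGrp.of (profiniteCompletion (FreeGroup (Fin n)) × absoluteGaloisGroup K),
        absoluteGaloisGrp K,
        ContinuousMonoidHom.snd (profiniteCompletion (FreeGroup (Fin n))) (absoluteGaloisGroup K),
        Prod.snd_surjective⟩ : FundamentalExtension.{0}).arith ≃ₜ*
      (⟨ProfiniteGrp.of (profiniteCompletion (FreeGroup (Fin m)) × absoluteGaloisGroup L),
        absoluteGaloisGrp L,
        ContinuousMonoidHom.snd (profiniteCompletion (FreeGroup (Fin m))) (absoluteGaloisGroup L),
        Prod.snd_surjective⟩ : FundamentalExtension.{0}).arith) :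
    p = q :=
  (thm214GroupPart_split_profiniteCompletion_freeGroup n p K m q L φ).1

end FundamentalExtension

end Literature.AnabelianGeometry.AbsoluteAnabelian

end
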